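import Literature.MathematicalPhysics.QuantumFieldTheory.Balaban1983to89.StrongCouplingVarianceWindow

/-!
# `InfraRed.StrongCouplingPoincareWindow` — the `SU(2)` strong-coupling window as a function of the one-link
# Poincaré constant (lineage IR-SC, certificate J-SC10; cell `pub-balaban`, tree target `Summits/QuantumFields/BalabanUV/InfraRed/`)

HONEST FRAMING (verbatim, binding): «observatory of the non-perturbative crossover; no mass-gap claim».
This is the STRONG-COUPLING front of the two-front crossover ledger (IR-3 v2) for `SU(2)`, `d = 4`, Wilson action,
`β_W = 4/g²` (tree bare coupling `β_W/2`, 't Hooft coupling `β_W/4`).  Elementary and kernel-checked; NOT a statement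
about Bałaban's renormalisation group, NOT the continuum, NOT Clay, NOT summit progress.

ABSOLUTE RULE.  No internally-minted statement may enter as a cited fact.  Every hypothesis is either kernel-proved in this
package or a verbatim quotation of a PUBLISHED theorem with page reference.  The manuscript(s) under audit are NOT citable for
their own disputed steps — they are the thing under adjudication; programme-internal (2001/route/tribunal) claims are never
citable.  In this file NOTHING printed is used as a hypothesis and nothing is cited: every statement is proved from Mathlib and
from the tree's definitions and theorems (`OneLinkKRModulus`, `OneLinkKRModulusSU2`, `pot`, `integral_var_tilted_le`,
`SUNBakryEmery.haarPoincare_SU`, the covariance-interpolation lemma `abs_integral_tilted_add_sub_le_of_cov`, the doors of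
`StrongCouplingTorusWindow` / `StrongCouplingDobrushinWindow` / `StrongCouplingOpenWindow`), imported BY NAME and not modified.
The two `def … : Prop` below are a HYPOTHESIS SCHEMA (`OneLinkPoincareSU2 R c`, of which the Bakry–Émery instance
`c = 1/(1 − 2R)` is PROVED here from the tree) and a TYPED TARGET (`SharpPoincareSU2`, open), used only as explicit
hypotheses; the target is neither proved nor cited nor claimed.

WHAT THIS FILE PROVES.
* `OneLinkPoincareSU2 R c` — schema: every one-link law `ν_B = σ.tilted (2 Re tr(· B))` of `SU(2)` with `‖B‖_op ≤ R`
  satisfies the Poincaré inequality in Lipschitz form `Var_{ν_B}(ψ) ≤ c · M²` for `M`-Lipschitz `ψ` (Frobenius distance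
  `d_F = √2 ·` the Euclidean distance of `ℝ⁴ ⊃ S³ ≅ SU(2)`; so `c = 2/λ` if `λ` is a lower bound of the spectral gap of `ν_B`).
* `oneLinkPoincareSU2_bakryEmery` — the tree's Bakry–Émery theorem IS the instance `c = 1/(1 − 2R)` (`R < 1/2`), unconditional.
* `oneLinkKRModulus_two_of_poincare` — **the modulus as a function of the Poincaré constant**: for `R ≤ 1/4` and `0 < c`,
  `OneLinkPoincareSU2 R c → OneLinkKRModulus 2 R √(2c)`.  Proof = the covariance interpolation of J-SC8
  (`StrongCouplingVarianceWindow.oneLinkKRModulus_su2_var`) with the variance of the observable taken from the schema instead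
  of from Bakry–Émery; the variance of the perturbing potential is the tree's `integral_var_tilted_le` (`≤ 2‖B − B'‖_F²`, needs
  `R ≤ 1/4`).  With `c = 1/(1 − 2R)` it returns EXACTLY J-SC8's `K(R) = √(2/(1 − 2R))` (the `example` after it; the statement itself is the
  landed `oneLinkKRModulus_su2_var`, not re-declared):
  the owned window `β_W ≤ 0.124` is the Bakry–Émery point of a one-parameter family, and this file types the parameter.
* `SharpPoincareSU2` (`@[conjecture]`, TYPED TARGET, open) — the schema at the HAAR constant on the ball `R ≤ 1/4`:
  `OneLinkPoincareSU2 (1/4) (2/3)`, i.e. `Var_{ν_B}(ψ) ≤ (2/3) M²`, the value `2/λ₁(S³)`, `λ₁(S³) = 3`, that the uniform measure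
  itself attains (Bakry–Émery gives `2/2 = 1` at `B = 0` and `1/(1 − 2R)` on the ball).  Under it:
  `oneLinkKRModulusSU2_of_sharpPoincare : SharpPoincareSU2 → 0 ≤ βW → βW ≤ 1/6 → OneLinkKRModulusSU2 βW (√(4/3)/4)`
  (`K₂ = 1/(2√3) = 0.2887`), the window inequality `18 βW K₂ < 1` holds on the whole radius range `βW ≤ 1/6`
  (`su2_window_of_sharpPoincare`; it would hold up to `βW < √3/9 = 0.19245`, `su2_sharpPoincare_window_iff`, but the variance
  lemma of the tree is typed for `R ≤ 1/4` only), and the three doors open on `[0, 1/6]`: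
  `su2_strongCouplingFront_of_sharpPoincare`, `su2_dlrMassGapAt_of_sharpPoincare`, `su2_latticeMassGap_of_sharpPoincare`.
  THE OWNED NUMBER IS UNCHANGED (`β_W ≤ 0.124`, J-SC8, hypothesis-free); `1/6` is CONDITIONAL on the target.

STATUS OF THE TARGET (not used, recorded for honesty).  Off kernel, the spectral gap of the generator
`Δ_{S³} + κ ∇x₀·∇` of `ν_κ ∝ e^{κ x₀} σ` computed by two independent one-dimensional solvers (separation of variables in the
polar angle about the tilt axis; sectors `ℓ = 0, 1, 2`) is `≥ 3` for every `κ ≥ 0` tried and INCREASING in `κ`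
(`3.000, 3.033, 3.132, 3.295, 3.516` at `κ = 0, 0.5, 1, 1.5, 2`; the relevant range for `R ≤ 1/4` is `κ ≤ 1`); engines, tables
and limits are in the lineage record `ir/FRONT-SC.md` (J-SC10) — evidence, not a certificate, and nothing in this file depends
on it.  In print we found a UNIFORM (in the field) logarithmic Sobolev inequality for these measures on spheres with an
inexplicit constant (one-dimensional Muckenhoupt-type criteria); we found no printed proof of the sharp constant.  That remark
is context, not a citation, and is not used.

VERSIONS: v1 (IR-SC gen 6; re-cut after the courier dry-run l.2256: the J-SC8 consistency check is an `example`, dedup.landed).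
-/

open MeasureTheory Real ProbabilityTheory
open Literature.MathematicalPhysics.QuantumFieldTheory
open Literature.MathematicalPhysics.QuantumFieldTheory.Balaban1983to89
open Literature.MathematicalPhysics.QuantumLattice (su2Quat fundamentalRep fundamentalLatticeRep)
open Literature.MathematicalPhysics.QuantumFieldTheory.Balaban1983to89.StrongCouplingDobrushinWindow
open Literature.MathematicalPhysics.QuantumFieldTheory.Balaban1983to89.StrongCouplingTorusWindow
open Literature.MathematicalPhysics.QuantumFieldTheory.Balaban1983to89.StrongCouplingKernelWindow
open Literature.MathematicalPhysics.QuantumFieldTheory.Balaban1983to89.StrongCouplingOpenWindow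
open Literature.MathematicalPhysics.QuantumFieldTheory.Balaban1983to89.StrongCouplingVarianceWindow

namespace Summit.QuantumFields.BalabanUV.InfraRed.StrongCouplingPoincareWindow

local notation "SU2" => Matrix.specialUnitaryGroup (Fin 2) ℂ
local notation "M₂" => Matrix (Fin 2) (Fin 2) ℂ
local notation "σ₂" => haarProbability (Matrix.specialUnitaryGroup (Fin 2) ℂ)

/-! ## Part A: the one-link Poincaré constant as a hypothesis schema, and its Bakry–Émery instance -/

/-- HYPOTHESIS SCHEMA (typed parameter, not a claim): **the one-link Poincaré inequality of `SU(2)` in Lipschitz form with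
constant `c` on the ball of radius `R`** — for every `B` with `‖B‖_op ≤ R` and every `M`-Lipschitz `ψ` (Frobenius distance),
`Var_{ν_B}(ψ) ≤ c · M²`, `ν_B = σ.tilted (pot B)`, `pot B = 2 Re tr(· B)`.  In terms of a spectral-gap lower bound `λ` of
`ν_B` on `S³` (Euclidean gradient) this is `c = 2/λ`.  Instances: Bakry–Émery `c = 1/(1 − 2R)` (proved below from the tree);
the Haar value `c = 2/3` is the typed target `SharpPoincareSU2`. [folklore] -/
@[conjecture]
def OneLinkPoincareSU2 (R c : ℝ) : Prop :=
  ∀ B : M₂, matrixOpNorm B ≤ R →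
    ∀ (ψ : SU2 → ℝ) (M : ℝ), 0 ≤ M → (∀ a b, |ψ a - ψ b| ≤ M * suFrobDist a b) →
      Var[ψ; (σ₂).tilted (pot B)] ≤ c * M ^ 2

/-- The schema is monotone in the radius. [folklore] -/
theorem OneLinkPoincareSU2.mono_radius {R R' c : ℝ} (h : OneLinkPoincareSU2 R c) (hle : R' ≤ R) :
    OneLinkPoincareSU2 R' c :=
  fun B hB ψ M hM hψ => h B (hB.trans hle) ψ M hM hψ

/-- **The Bakry–Émery instance** (unconditional, the tree's `SUNBakryEmery.haarPoincare_SU` at `N = 2`): for `R < 1/2`,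
`OneLinkPoincareSU2 R (1/(1 − 2R))`. [folklore] -/
theorem oneLinkPoincareSU2_bakryEmery {R : ℝ} (hR : R < 1 / 2) : OneLinkPoincareSU2 R (1 / (1 - 2 * R)) := by
  intro B hB ψ M hM hψ
  have hBlt : matrixOpNorm B < 1 / 2 := lt_of_le_of_lt hB hR
  have hvar := SUNBakryEmery.haarPoincare_SU (N := 2) le_rfl B hBlt ψ M hM hψ
  have h2 : ((2 : ℕ) : ℝ) = 2 := by norm_num
  rw [h2] at hvar
  have h12 : 0 < 1 - 2 * R := by linarith
  have hden : 0 < (2 : ℝ) * (1 / 2 - matrixOpNorm B) := by linarith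
  calc Var[ψ; (σ₂).tilted (pot B)] ≤ M ^ 2 / (2 * (1 / 2 - matrixOpNorm B)) := hvar
    _ ≤ M ^ 2 / (1 - 2 * R) := div_le_div_of_nonneg_left (sq_nonneg M) h12 (by linarith)
    _ = 1 / (1 - 2 * R) * M ^ 2 := by rw [div_eq_mul_one_div, mul_comm]

/-! ## Part B: the modulus as a function of the Poincaré constant -/

/-- **`OneLinkPoincareSU2 R c → OneLinkKRModulus 2 R √(2c)`** for `R ≤ 1/4`, `0 < c`.  Covariance interpolation along
`ν_{(1−t)B + tB'}` (`abs_integral_tilted_add_sub_le_of_cov`): `|Cov_{ν_{B_t}}(φ, w)| ≤ √(Var φ · Var w)` with `Var φ ≤ c L²`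
(the schema) and `Var w ≤ ∫ w² dσ ≤ 2‖B' − B‖_F²` (the tree's `integral_var_tilted_le`, which needs `|pot B_t| ≤ 4R ≤ 1`),
`w = pot (B' − B)`. [folklore] -/
theorem oneLinkKRModulus_two_of_poincare {R c : ℝ} (hR : R ≤ 1 / 4) (hc : 0 < c) (hP : OneLinkPoincareSU2 R c) :
    OneLinkKRModulus 2 R (Real.sqrt (2 * c)) := by
  classical
  intro B B' hB hB' φ L hφm hφb hL hφL
  set Kc : ℝ := Real.sqrt (2 * c) with hKc
  have hKc0 : 0 ≤ Kc := Real.sqrt_nonneg _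
  have hKc2 : Kc ^ 2 = 2 * c := Real.sq_sqrt (by positivity)
  have h2 : ((2 : ℕ) : ℝ) = 2 := by norm_num
  rw [h2]
  -- the potentials, with the real numeral `2`
  set f : SU2 → ℝ := fun g => (2 : ℝ) * (((g : M₂) * B).trace.re) with hf
  set w : SU2 → ℝ := fun g => (2 : ℝ) * (((g : M₂) * (B' - B)).trace.re) with hw
  have hfw : (fun g : SU2 => (2 : ℝ) * (((g : M₂) * B').trace.re)) = fun g => f g + w g := by
    funext g
    simp only [hf, hw, Matrix.mul_sub, Matrix.trace_sub, Complex.sub_re]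
    ring
  rw [hfw, abs_sub_comm]
  have hfm : Measurable f := (continuous_const.mul (continuous_re_trace_su_mul B)).measurable
  have hwm : Measurable w := (continuous_const.mul (continuous_re_trace_su_mul (B' - B))).measurable
  have hfb : ∃ C, ∀ s, |f s| ≤ C := ⟨2 * (2 * matrixOpNorm B), fun s => by
    simp only [hf]
    rw [abs_mul, abs_two]
    exact mul_le_mul_of_nonneg_left (abs_re_trace_su2_mul_le_opNorm s B) zero_le_two⟩
  set Bw : ℝ := 2 * (Real.sqrt 2 * frobNorm (B' - B)) with hBw
  have hwb : ∀ s, |w s| ≤ Bw := fun s => by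
    simp only [hw, hBw]
    rw [abs_mul, abs_two]
    exact mul_le_mul_of_nonneg_left (abs_re_trace_su2_mul_le_frob s _) zero_le_two
  have key := abs_integral_tilted_add_sub_le_of_cov (μ := σ₂) (A := Kc * L * frobNorm (B' - B))
    hfm hfb hwm hwb hφm hφb ?_
  · rw [frobNorm_sub_comm]; exact key
  · intro t ht
    -- the interpolated tilt is the one-link law at `B_t`, `‖B_t‖_op ≤ R`
    set Bt : M₂ := B + (t : ℂ) • (B' - B) with hBt
    have hft : (fun u : SU2 => f u + t * w u) = pot Bt := by
      funext g
      simp only [hf, hw, hBt, pot, Matrix.mul_add, Matrix.mul_smul, Matrix.trace_add, Matrix.trace_smul,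
        Complex.add_re, smul_eq_mul, Complex.re_ofReal_mul]
      ring
    have hBt_le : matrixOpNorm Bt ≤ R := by
      have h1 : Bt = ((1 - t : ℝ) : ℂ) • B + ((t : ℝ) : ℂ) • B' := by
        rw [hBt]
        push_cast
        simp only [smul_sub, sub_smul, one_smul]
        abel
      rw [h1]
      calc matrixOpNorm (((1 - t : ℝ) : ℂ) • B + ((t : ℝ) : ℂ) • B')
          ≤ matrixOpNorm (((1 - t : ℝ) : ℂ) • B) + matrixOpNorm (((t : ℝ) : ℂ) • B') := matrixOpNorm_add_le _ _
        _ = (1 - t) * matrixOpNorm B + t * matrixOpNorm B' := by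
            rw [matrixOpNorm_smul, matrixOpNorm_smul, Complex.norm_real, Complex.norm_real, Real.norm_eq_abs,
              Real.norm_eq_abs, abs_of_nonneg (by linarith [ht.2]), abs_of_nonneg ht.1]
        _ ≤ (1 - t) * R + t * R :=
            add_le_add (mul_le_mul_of_nonneg_left hB (by linarith [ht.2])) (mul_le_mul_of_nonneg_left hB' ht.1)
        _ = R := by ring
    rw [hft]
    set ν : Measure SU2 := Measure.tilted σ₂ (pot Bt) with hν
    have hFm : Measurable (pot Bt) := (continuous_const.mul (continuous_re_trace_su_mul Bt)).measurable
    have hFκ : ∀ s, |pot Bt s| ≤ 4 * R := fun s => by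
      simp only [pot]
      rw [abs_mul, abs_two]
      calc 2 * |((s : M₂) * Bt).trace.re| ≤ 2 * (2 * matrixOpNorm Bt) :=
            mul_le_mul_of_nonneg_left (abs_re_trace_su2_mul_le_opNorm s Bt) zero_le_two
        _ ≤ 4 * R := by linarith
    have hexpF : Integrable (fun s => exp (pot Bt s)) σ₂ :=
      integrable_of_measurable_of_abs_le hFm.exp (C := exp (4 * R)) fun s => by
        rw [abs_of_nonneg (exp_pos _).le]; exact exp_le_exp.2 ((le_abs_self _).trans (hFκ s))
    haveI : IsProbabilityMeasure ν := isProbabilityMeasure_tilted hexpF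
    -- the variance of the observable: the schema
    have hVφ : ∫ s, (φ s - ∫ s', φ s' ∂ν) ^ 2 ∂ν ≤ (Kc * L) ^ 2 / 2 := by
      have hvar := hP Bt hBt_le φ L hL hφL
      rw [variance_eq_integral hφm.aemeasurable] at hvar
      refine hvar.trans (le_of_eq ?_)
      rw [mul_pow, hKc2]
      ring
    -- the variance of the perturbation: at most its Haar variance (tree)
    have hw2 : ∀ s : SU2, w s ^ 2 = 4 * (((s : M₂) * (B' - B)).trace.re) ^ 2 := fun s => by
      simp only [hw]; ring
    have hEσ : ∫ s, w s ^ 2 ∂σ₂ ≤ 2 * frobNorm (B' - B) ^ 2 := by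
      simp_rw [hw2]
      rw [integral_const_mul, integral_sq_re_trace_su2_mul]
      linarith [coef_sq_le (B' - B)]
    have h4R : 4 * R ≤ 1 := by linarith
    have hB1 : ∀ g : SU2, |pot Bt g| ≤ 1 := fun g => (hFκ g).trans h4R
    have hVw : ∫ s, (w s - ∫ s', w s' ∂ν) ^ 2 ∂ν ≤ (2 * frobNorm (B' - B)) ^ 2 / 2 := by
      have hM : (2 * frobNorm (B' - B)) ^ 2 / 2 = 2 * frobNorm (B' - B) ^ 2 := by ring
      rw [hM]
      have hV := integral_var_tilted_le Bt (B' - B) hB1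
      exact hV.trans hEσ
    -- Cauchy–Schwarz
    have hcov := abs_integral_mul_sub_le_of_variance_le (ν := ν) (K := 2) two_pos (mul_nonneg hKc0 hL)
      (mul_nonneg zero_le_two (frobNorm_nonneg _)) hφm hφb hwm ⟨Bw, hwb⟩ hVφ hVw
    refine hcov.trans (le_of_eq ?_)
    ring

/- **Consistency with J-SC8** (an `example`, so that the gate's dedup of landed statements is respected: the TYPE below is
exactly the landed `StrongCouplingVarianceWindow.oneLinkKRModulus_su2_var`): the Bakry–Émery instance fed through
`oneLinkKRModulus_two_of_poincare` returns the owned modulus `K(R) = √(2/(1 − 2R))` (`R ≤ 1/4`). -/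
example {R : ℝ} (hR : R ≤ 1 / 4) : OneLinkKRModulus 2 R (Real.sqrt (2 / (1 - 2 * R))) := by
  have h12 : 0 < 1 - 2 * R := by linarith
  have h := oneLinkKRModulus_two_of_poincare hR (by positivity) (oneLinkPoincareSU2_bakryEmery (by linarith))
  have e : 2 * (1 / (1 - 2 * R)) = 2 / (1 - 2 * R) := by field_simp
  rwa [e] at h

/-- In the ledger's units: `OneLinkPoincareSU2 (3βW/2) c → OneLinkKRModulusSU2 βW (√(2c)/4)` for `βW ≤ 1/6`, `0 < c`.
[folklore] -/
theorem oneLinkKRModulusSU2_of_poincare {βW c : ℝ} (h6 : βW ≤ 1 / 6) (hc : 0 < c)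
    (hP : OneLinkPoincareSU2 (3 * βW / 2) c) : OneLinkKRModulusSU2 βW (Real.sqrt (2 * c) / 4) := by
  have h := oneLinkKRModulus_two_of_poincare (R := 3 * βW / 2) (by linarith) hc hP
  have e : 4 * (Real.sqrt (2 * c) / 4) = Real.sqrt (2 * c) := by ring
  show OneLinkKRModulus 2 (3 * βW / 2) (4 * (Real.sqrt (2 * c) / 4))
  rwa [e]

/-- The window inequality as a function of the constant: `18 βW (√(2c)/4) < 1 ↔ 81 βW² c < 2` (`0 ≤ βW`, `0 < c`).
[folklore] -/
theorem su2_window_iff_of_poincare {βW c : ℝ} (h0 : 0 ≤ βW) (hc : 0 < c) :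
    18 * βW * (Real.sqrt (2 * c) / 4) < 1 ↔ 81 * βW ^ 2 * c < 2 := by
  have hs0 : 0 ≤ Real.sqrt (2 * c) := Real.sqrt_nonneg _
  have hs2 : Real.sqrt (2 * c) ^ 2 = 2 * c := Real.sq_sqrt (by positivity)
  have e : 18 * βW * (Real.sqrt (2 * c) / 4) = (9 * βW / 2) * Real.sqrt (2 * c) := by ring
  rw [e]
  constructor
  · intro h
    have hx0 : 0 ≤ (9 * βW / 2) * Real.sqrt (2 * c) := by positivity
    have hsq : ((9 * βW / 2) * Real.sqrt (2 * c)) ^ 2 < 1 := by nlinarith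
    rw [mul_pow, hs2] at hsq
    nlinarith
  · intro h
    have hsq : ((9 * βW / 2) * Real.sqrt (2 * c)) ^ 2 < 1 := by rw [mul_pow, hs2]; nlinarith
    have hx0 : 0 ≤ (9 * βW / 2) * Real.sqrt (2 * c) := by positivity
    nlinarith

/-! ## Part C: the typed target `SharpPoincareSU2` — the Haar constant on the ball `R ≤ 1/4` -/

/-- TYPED TARGET (open; NOT proved, NOT cited, used only as an explicit hypothesis): **the one-link laws of `SU(2)` with
`‖B‖_op ≤ 1/4` satisfy the Poincaré inequality with the HAAR constant**, `OneLinkPoincareSU2 (1/4) (2/3)`: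
`Var_{ν_B}(ψ) ≤ (2/3) M²` for `M`-Lipschitz `ψ` (Frobenius distance) — the value `2/λ₁(S³)`, `λ₁(S³) = 3`, attained by
the uniform measure; equivalently "tilting Haar measure on `SU(2) ≅ S³` by `e^{2 Re tr(g B)}`, `‖B‖_op ≤ 1/4`, does not
lower the spectral gap below `3`".  Bakry–Émery gives only `c = 1/(1 − 2R) ∈ [1, 2]` on this ball. [folklore] -/
@[conjecture]
def SharpPoincareSU2 : Prop :=
  OneLinkPoincareSU2 (1 / 4) (2 / 3)

/-- Under `SharpPoincareSU2`: `OneLinkKRModulusSU2 βW (√(4/3)/4)` (`K₂ = 1/(2√3) = 0.2887`) for every `βW ≤ 1/6`.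
[folklore] -/
theorem oneLinkKRModulusSU2_of_sharpPoincare (h : SharpPoincareSU2) {βW : ℝ} (h6 : βW ≤ 1 / 6) :
    OneLinkKRModulusSU2 βW (Real.sqrt (4 / 3) / 4) := by
  have hP : OneLinkPoincareSU2 (3 * βW / 2) (2 / 3) := OneLinkPoincareSU2.mono_radius h (by linarith)
  have hm := oneLinkKRModulusSU2_of_poincare h6 (by norm_num) hP
  have e : (2 : ℝ) * (2 / 3) = 4 / 3 := by norm_num
  rwa [e] at hm

/-- The window inequality at `K₂ = √(4/3)/4` holds exactly for `βW < √3/9 = 0.19245…` (`0 ≤ βW`). [folklore] -/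
theorem su2_sharpPoincare_window_iff {βW : ℝ} (h0 : 0 ≤ βW) :
    18 * βW * (Real.sqrt (4 / 3) / 4) < 1 ↔ βW < Real.sqrt 3 / 9 := by
  have e : (4 : ℝ) / 3 = 2 * (2 / 3) := by norm_num
  rw [e, su2_window_iff_of_poincare h0 (by norm_num)]
  have hs3 : Real.sqrt 3 * Real.sqrt 3 = 3 := Real.mul_self_sqrt (by norm_num)
  have hs0 : 0 < Real.sqrt 3 := Real.sqrt_pos.2 (by norm_num)
  constructor
  · intro h
    by_cases hge : Real.sqrt 3 / 9 ≤ βW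
    · exfalso
      have h1 : (Real.sqrt 3 / 9) * (Real.sqrt 3 / 9) ≤ βW * βW := mul_le_mul hge hge (by positivity) h0
      nlinarith
    · exact not_le.mp hge
  · intro h
    have h1 : βW * βW < (Real.sqrt 3 / 9) * (Real.sqrt 3 / 9) := mul_lt_mul'' h h h0 h0
    nlinarith

/-- On the radius range of the target, `βW ≤ 1/6 < √3/9`, the window inequality holds. [folklore] -/
theorem su2_window_of_sharpPoincare {βW : ℝ} (h0 : 0 ≤ βW) (h6 : βW ≤ 1 / 6) :
    18 * βW * (Real.sqrt (4 / 3) / 4) < 1 := by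
  have hs : Real.sqrt (4 / 3) < 6 / 5 := by
    rw [Real.sqrt_lt' (by norm_num)]; norm_num
  have hs0 : 0 ≤ Real.sqrt (4 / 3) := Real.sqrt_nonneg _
  nlinarith

/-- SC-b under the target: `SharpPoincareSU2 → StrongCouplingFront (fundamentalLatticeRep 2) (β₀W/2)` for every
`0 ≤ β₀W ≤ 1/6` (volume-uniform clustering of Wilson loops on every torus `(ℤ/Lℤ)⁴` at every Wilson coupling `≤ β₀W`;
the tree's door `su2_strongCouplingFront_of_oneLinkKRModulus`).  CONDITIONAL; the owned hypothesis-free number is `0.124`.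
[folklore] -/
theorem su2_strongCouplingFront_of_sharpPoincare (h : SharpPoincareSU2) {β₀W : ℝ} (h0 : 0 ≤ β₀W) (h6 : β₀W ≤ 1 / 6) :
    CrossoverLedger.StrongCouplingFront (fundamentalLatticeRep 2) (β₀W / 2) :=
  su2_strongCouplingFront_of_oneLinkKRModulus (by positivity) (oneLinkKRModulusSU2_of_sharpPoincare h h6)
    (su2_window_of_sharpPoincare h0 h6)

/-- SC-a under the target: `SharpPoincareSU2 → DLRMassGapAt 4 2 (βW/4)` for every `0 ≤ βW ≤ 1/6` (unique Gibbs measure and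
exponential clustering of the `SU(2)` Wilson DLR specification on `ℤ⁴`; the tree's door `su2_dlrMassGapAt_of_oneLinkKRModulus`).
CONDITIONAL. [folklore] -/
theorem su2_dlrMassGapAt_of_sharpPoincare (h : SharpPoincareSU2) {βW : ℝ} (h0 : 0 ≤ βW) (h6 : βW ≤ 1 / 6) :
    DLRMassGapAt 4 2 (βW / 4) :=
  su2_dlrMassGapAt_of_oneLinkKRModulus h0 (by positivity) (oneLinkKRModulusSU2_of_sharpPoincare h h6)
    (su2_window_of_sharpPoincare h0 h6)

/-- SC-c under the target: `SharpPoincareSU2 → LatticeMassGap (fundamentalRep (Fin 2)) (βW/2) (krRate (18 βW K₂))`,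
`K₂ = √(4/3)/4`, for every `0 ≤ βW ≤ 1/6` (transfer-operator gap uniform in the spatial volume; the tree's door
`su2_latticeMassGap_of_oneLinkKRModulusSU2`).  CONDITIONAL. [folklore] -/
theorem su2_latticeMassGap_of_sharpPoincare (h : SharpPoincareSU2) {βW : ℝ} (h0 : 0 ≤ βW) (h6 : βW ≤ 1 / 6) :
    CrossoverLedger.LatticeMassGap (fundamentalRep (Fin 2)) (βW / 2) (krRate (18 * βW * (Real.sqrt (4 / 3) / 4))) :=
  su2_latticeMassGap_of_oneLinkKRModulusSU2 h0 (by positivity) (oneLinkKRModulusSU2_of_sharpPoincare h h6)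
    (su2_window_of_sharpPoincare h0 h6)

end Summit.QuantumFields.BalabanUV.InfraRed.StrongCouplingPoincareWindow
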